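import Mathlib
import Summits.BirchSwinnertonDyer.Rank1Residual.ManinAdditive.TwoEisensteinRankOneLaws
import Literature.NumberTheory.EllipticCurves.PastenSpectralDegreeProofs
import Literature.NumberTheory.EllipticCurves.NewformsCoeffFieldLatticeProofs
import HarnessLib

/-!
# E-imc-90 `OddCongruenceNumberOfIsolationCertificate` holds: a 2-adic isolation certificate forces an odd congruence number

Summit `BirchSwinnertonDyer`, route `ManinLocalTwoThree` (cell bsd-f2-manin), deciding crux C2 `ManinOddAtFour`
(stmt-BirchSwinnertonDyer-22967); IMC lens (planner-of-record imc g15, MEMO-imc §21; typed leaf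
`…ManinAdditive.TwoEisensteinRankOneLaws`).  PROVED HERE, unconditionally: `OddCongruenceNumberOfIsolationCertificate_holds`.
THE ARGUMENT (Pasten 2024, §5.6, second proof of Thm. 5.5, with the isolation certificate in place of multiplicity one;
all over `ℝ`/`ℤ`).  `T = T_ℓ` on `V = S₂(Γ₀(N))`, `T f = a f`, `a₁(f) = 1`, `f ∈ S(ℤ)`, `ℓ ∤ N` odd, `a` even, `z ≠ 0` the
certified integer `det_ℂ((1+ℓ) − T)` with `v₂(z) = v₂(1+ℓ−a)`.  (1) Shimura's Hecke-stable lattice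
(`gamma0_exists_heckeStableLattice_two`) makes `χ_ℝ(T) = P ⊗ ℝ`, `P ∈ ℤ[X]`.  (2) `P(1+ℓ) = det_ℝ = N_{ℂ/ℝ} det_ℂ = z²`
(`LinearMap.det_restrictScalars`).  (3) `f, i f` are real `a`-eigenvectors, so `P = (X − a)² ρ`
(`LinearMap.finrank_eigenspace_le`); the certificate gives `ρ(1+ℓ)` odd, so `R := ρ(a)` is odd (`2 ∣ 1+ℓ−a`), `a` has
multiplicity exactly `2` in `χ_ℝ(T)` and **`ker(T − a) = ℂ f`**.  (4) Eigenvalues of `T` are real (`heckeT_selfAdjoint_holds`),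
so `ρ` kills every eigenvalue `λ ≠ a` and `ϖ := ρ(T) ∈ ℤ[T]` acts as `R · π_f` (`exists_aeval_heckeT_apply_eq_smul`, the
`T_ℓ`-only twin of the tree's `exists_apply_eq_smul_of_forall_mem_minimalPrimes`) and preserves `S(ℤ)`.  (5) Counting as in
the tree's `congruenceNumber_dvd_prod_heckeCongruenceModulus`: `S(ℤ)/(ℤf + (ℤf)^⊥) ↪ ℤ/R`, so `r_f ∣ R` is odd.
Nothing about BSD, Manin's conjecture or any Manin constant is asserted or proved here.
-/

set_option linter.dupNamespace false

noncomputable section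

open scoped MatrixGroups ModularForm ComplexConjugate
open CongruenceSubgroup UpperHalfPlane Polynomial
open Literature.NumberTheory.EllipticCurves Literature.NumberTheory.EllipticCurves.ModularForms
open Summit.BirchSwinnertonDyer.Rank1Residual.ManinAdditive.TwoEisenstein

namespace Summit.BirchSwinnertonDyer.BirchSwinnertonDyer.Theorems.ManinLocalTwoThree

variable {N : ℕ} [NeZero N]

/-- **Integrality of the characteristic polynomial of `T_ℓ` over `ℝ`.**  By Shimura's Hecke-stable lattice
(`gamma0_exists_heckeStableLattice_two`, Shimura 1971 (3.5.20)) the matrix of `T_ℓ` in a suitable `ℝ`-basis of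
`S₂(Γ₀(N))` has integer entries, so the characteristic polynomial of `T_ℓ` as an `ℝ`-linear map is `P ⊗ ℝ` for some
`P ∈ ℤ[X]`. [cite: Shimura1971, Thm. 3.48 and (3.5.20) p. 84] -/
theorem exists_intPoly_map_eq_charpoly_heckeT [Module.Finite ℝ (CuspForm (Gamma0 N) 2)]
    (ℓ : ℕ) [NeZero ℓ] (hℓ : ℓ.Prime) :
    ∃ P : ℤ[X], P.map (Int.castRingHom ℝ) = ((heckeT (Gamma0 N) 2 ℓ).restrictScalars ℝ).charpoly := by
  classical
  obtain ⟨n, b, hb⟩ := gamma0_exists_heckeStableLattice_two N (le_refl _)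
  have hint : ∀ i j, ∃ m : ℤ, (m : ℝ) =
      LinearMap.toMatrix b b ((heckeT (Gamma0 N) 2 ℓ).restrictScalars ℝ) i j := by
    intro i j
    rw [LinearMap.toMatrix_apply, LinearMap.coe_restrictScalars]
    have hmem : heckeT (Gamma0 N) 2 ℓ (b j) ∈ Submodule.span ℤ (Set.range b) := hb ℓ hℓ j
    obtain ⟨m, hm⟩ := (Module.Basis.mem_span_iff_repr_mem ℤ b _).mp hmem i
    exact ⟨m, by rw [← hm]; simp⟩
  choose M hM using hint
  refine ⟨(Matrix.of fun i j ↦ M i j).charpoly, ?_⟩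
  rw [← LinearMap.charpoly_toMatrix _ b, ← Matrix.charpoly_map]
  congr 1
  ext i j
  simp [hM]

/-- **`χ_ℝ(T)(c) = N_{ℂ/ℝ}(det_ℂ(c − T)) = |det_ℂ(c − T)|²`** for a `ℂ`-linear endomorphism `T` of a finite-dimensional
complex vector space viewed as a real one, and real `c` (`LinearMap.det_restrictScalars`). [folklore] -/
theorem charpoly_restrictScalars_eval {E : Type*} [AddCommGroup E] [Module ℂ E] [FiniteDimensional ℂ E]
    (T : Module.End ℂ E) (c : ℝ) :
    ((T.restrictScalars ℝ).charpoly).eval c =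
      Complex.normSq (LinearMap.det ((c : ℂ) • (1 : Module.End ℂ E) - T)) := by
  rw [LinearMap.eval_charpoly]
  have h : algebraMap ℝ (Module.End ℝ E) c - T.restrictScalars ℝ =
      (((c : ℂ) • (1 : Module.End ℂ E) - T)).restrictScalars ℝ := by
    ext v
    simp [Complex.coe_smul]
  rw [h, LinearMap.det_restrictScalars, Algebra.norm_complex_apply]

/-- An integer polynomial in `T_ℓ` (`ℓ ∤ N` prime) preserves `S₂(Γ₀(N); ℤ)` (from `heckeT_mem_integralCuspForms0`). [folklore] -/
theorem aeval_heckeT_mem_integralCuspForms0 (ℓ : ℕ) [NeZero ℓ] (hℓ : ℓ.Prime) (hℓN : ¬ ℓ ∣ N)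
    (q : ℤ[X]) {g : CuspForm (Gamma0 N) 2} (hg : g ∈ integralCuspForms0 N 2) :
    Polynomial.aeval (heckeT (Gamma0 N) 2 ℓ) (q.map (Int.castRingHom ℂ)) g ∈ integralCuspForms0 N 2 := by
  induction q using Polynomial.induction_on' with
  | add p q hp hq =>
    rw [Polynomial.map_add, map_add, LinearMap.add_apply]
    exact add_mem hp hq
  | monomial n m =>
    rw [Polynomial.map_monomial, Polynomial.aeval_monomial, Module.End.mul_apply,
      Module.algebraMap_end_apply, eq_intCast, Int.cast_smul_eq_zsmul]
    refine Submodule.smul_mem _ m ?_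
    induction n with
    | zero => rwa [pow_zero, Module.End.one_apply]
    | succ n ih =>
      rw [pow_succ', Module.End.mul_apply]
      exact heckeT_mem_integralCuspForms0 ℓ hℓ hℓN ih


/-- **`ρ(T_ℓ) = R · π_f` on `S₂(Γ₀(N))`** — the `T_ℓ`-only twin of the tree's
`exists_apply_eq_smul_of_forall_mem_minimalPrimes` (Pasten 2024, §5.6).  Let `T_ℓ f = a f` (`a ∈ ℤ`, `f ≠ 0`,
`ℓ ∤ N` prime), suppose `ker(T_ℓ − a) = ℂ f`, and let `q ∈ ℂ[X]` vanish at every eigenvalue `λ ≠ a` of `T_ℓ`.  Then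
for every `g`, `q(T_ℓ) g = μ f` with `μ ⟨f, f⟩ = q(a) ⟨f, g⟩`.  Proof: `S₂(Γ₀(N))` is the sum of the eigenspaces of
the Petersson-self-adjoint `T_ℓ` (`heckeT_selfAdjoint_holds`, `maxGenEigenspace_eq_eigenspace_of_selfAdjoint`); on
`ℂ f` the operator `q(T_ℓ)` is `q(a)`, on the other eigenspaces it is `q(λ) = 0`, and those are orthogonal to `f`
(`a` being real). [cite: PastenShimura2024, §5.6 p. 19 (second proof of Thm. 5.5)] -/
theorem exists_aeval_heckeT_apply_eq_smul (ℓ : ℕ) [NeZero ℓ] (hℓ : ℓ.Prime) (hℓN : ¬ ℓ ∣ N)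
    {f : CuspForm (Gamma0 N) 2} (hf0 : f ≠ 0) {a : ℤ}
    (hTf : heckeT (Gamma0 N) 2 ℓ f = (a : ℂ) • f)
    (hone : ∀ u : CuspForm (Gamma0 N) 2, heckeT (Gamma0 N) 2 ℓ u = (a : ℂ) • u → u ∈ ℂ ∙ f)
    (q : ℂ[X])
    (hq : ∀ lam : ℂ, lam ≠ (a : ℂ) → (heckeT (Gamma0 N) 2 ℓ).HasEigenvalue lam → q.eval lam = 0)
    (g : CuspForm (Gamma0 N) 2) :
    ∃ μ : ℂ, Polynomial.aeval (heckeT (Gamma0 N) 2 ℓ) q g = μ • f ∧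
      μ * peterssonProduct (Gamma0 N) 2 f f = q.eval (a : ℂ) * peterssonProduct (Gamma0 N) 2 f g := by
  haveI : FiniteDimensional ℂ (CuspForm (Gamma0 N) 2) := finiteDimensional_cuspForm_gamma0 N 2
  have hgen : ∀ μ : ℂ, (heckeT (Gamma0 N) 2 ℓ).maxGenEigenspace μ = (heckeT (Gamma0 N) 2 ℓ).eigenspace μ :=
    fun μ ↦ maxGenEigenspace_eq_eigenspace_of_selfAdjoint (peterssonProduct (Gamma0 N) 2)
      (peterssonProduct_add_right 2) (peterssonProduct_smul_right (Gamma0 N) 2)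
      (fun v w ↦ peterssonProduct_conj_symm_holds (Gamma0 N) 2 v w)
      (eq_zero_of_peterssonProduct_self_eq_zero 2) (heckeT (Gamma0 N) 2 ℓ)
      (fun v w ↦ heckeT_selfAdjoint_holds N 2 ℓ hℓ hℓN v w) μ
  have hfev : (heckeT (Gamma0 N) 2 ℓ).HasEigenvector (a : ℂ) f :=
    ⟨Module.End.mem_eigenspace_iff.mpr hTf, hf0⟩
  have hg : g ∈ ⨆ μ : ℂ, (heckeT (Gamma0 N) 2 ℓ).maxGenEigenspace μ := by
    rw [Module.End.iSup_maxGenEigenspace_eq_top]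
    exact Submodule.mem_top
  refine Submodule.iSup_induction (fun μ : ℂ ↦ (heckeT (Gamma0 N) 2 ℓ).maxGenEigenspace μ)
    (motive := fun u ↦ ∃ c : ℂ, Polynomial.aeval (heckeT (Gamma0 N) 2 ℓ) q u = c • f ∧
      c * peterssonProduct (Gamma0 N) 2 f f = q.eval (a : ℂ) * peterssonProduct (Gamma0 N) 2 f u)
    hg ?_ ?_ ?_
  · intro lam u hu
    rw [hgen, Module.End.mem_eigenspace_iff] at hu
    by_cases hu0 : u = 0
    · refine ⟨0, ?_, ?_⟩
      · rw [hu0, map_zero, zero_smul]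
      · rw [hu0, peterssonProduct_zero_right, zero_mul, mul_zero]
    by_cases hlam : lam = (a : ℂ)
    · -- the eigenvalue of `f`: `u ∈ ℂ f`
      rw [hlam] at hu
      obtain ⟨ν, rfl⟩ := Submodule.mem_span_singleton.mp (hone u hu)
      refine ⟨ν * q.eval (a : ℂ), ?_, ?_⟩
      · rw [map_smul, Module.End.aeval_apply_of_hasEigenvector hfev, smul_smul]
      · rw [peterssonProduct_smul_right]
        ring
    · -- another eigenvalue: `q(T) u = q(λ) u = 0` and `u ⊥ f`
      have huev : (heckeT (Gamma0 N) 2 ℓ).HasEigenvector lam u :=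
        ⟨Module.End.mem_eigenspace_iff.mpr hu, hu0⟩
      have hq0 : q.eval lam = 0 := hq lam hlam (Module.End.hasEigenvalue_of_hasEigenvector huev)
      have horth : peterssonProduct (Gamma0 N) 2 f u = 0 := by
        have h := heckeT_selfAdjoint_holds N 2 ℓ hℓ hℓN f u
        rw [hTf, hu, peterssonProduct_smul_left, peterssonProduct_smul_right, map_intCast] at h
        have hne : (a : ℂ) - lam ≠ 0 := sub_ne_zero.mpr (Ne.symm hlam)
        have h' : ((a : ℂ) - lam) * peterssonProduct (Gamma0 N) 2 f u = 0 := by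
          rw [sub_mul, h, sub_self]
        exact (mul_eq_zero.mp h').resolve_left hne
      refine ⟨0, ?_, ?_⟩
      · rw [Module.End.aeval_apply_of_hasEigenvector huev, hq0, zero_smul, zero_smul]
      · rw [horth, zero_mul, mul_zero]
  · exact ⟨0, by rw [map_zero, zero_smul], by rw [peterssonProduct_zero_right, zero_mul, mul_zero]⟩
  · rintro x y ⟨μ, hμ, hμc⟩ ⟨ν, hν, hνc⟩
    refine ⟨μ + ν, ?_, ?_⟩
    · rw [map_add, hμ, hν, add_smul]
    · rw [add_mul, hμc, hνc, peterssonProduct_add_right, mul_add]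

/-- **E-imc-90 holds: `OddCongruenceNumberOfIsolationCertificate`.**  For `f ∈ S₂(Γ₀(N); ℤ)` with `a₁(f) = 1`,
`T_ℓ f = a f` at an odd prime `ℓ ∤ N` with `a` even, a 2-adic isolation certificate
`v₂ det((1+ℓ) − T_ℓ | S₂(Γ₀(N))) = v₂(1+ℓ−a)` forces the congruence number `r_f = #(S(ℤ)/(ℤf + (ℤf)^⊥))` to be odd.
See the module docstring for the proof (integral characteristic polynomial of `T_ℓ|_ℝ` from Shimura's lattice;
`det_ℝ = |det_ℂ|²`; `(X−a)² ∣ χ_ℝ` with odd cofactor value `R = ρ(a)`; `ker(T_ℓ − a) = ℂ f`; `ρ(T_ℓ) = R·π_f`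
preserves `S(ℤ)`; `S(ℤ)/(ℤf + (ℤf)^⊥) ↪ ℤ/R`).  Level-free and curve-free; nothing about BSD, Manin's conjecture
or any Manin constant is asserted. [cite: PastenShimura2024, §5.6 p. 19 (second proof of Thm. 5.5)]
[cite: AgasheRibetStein2012, §2.1] -/
theorem OddCongruenceNumberOfIsolationCertificate_holds : OddCongruenceNumberOfIsolationCertificate := by
  intro N _ ℓ hℓ f a hℓodd hℓN hfL hf1 hTf₀ ha hcert₀
  classical
  haveI : NeZero ℓ := ⟨hℓ.ne_zero⟩
  have hTf : heckeT (Gamma0 N) 2 ℓ f = (a : ℂ) • f := hTf₀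
  obtain ⟨z, hz0, hzdet, hzv⟩ : TwoAdicIsolationCertificate N ℓ a := hcert₀
  haveI : FiniteDimensional ℂ (CuspForm (Gamma0 N) 2) := finiteDimensional_cuspForm_gamma0 N 2
  have hf0 : f ≠ 0 := by
    intro h
    have h1 : (qExpansion 1 ⇑f).coeff 1 = 1 := hf1
    rw [h, CuspForm.coe_zero, UpperHalfPlane.qExpansion_zero, map_zero] at h1
    exact zero_ne_one h1
  set c : ℂ := peterssonProduct (Gamma0 N) 2 f f with hc
  have hc0 : c ≠ 0 := fun h0 ↦ hf0 (eq_zero_of_peterssonProduct_self_eq_zero 2 f h0)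
  -- Step 1: the characteristic polynomial of `T_ℓ|_ℝ` is an integer polynomial `P`
  obtain ⟨P, hP⟩ := exists_intPoly_map_eq_charpoly_heckeT (N := N) ℓ hℓ
  have hPne : ((heckeT (Gamma0 N) 2 ℓ).restrictScalars ℝ).charpoly ≠ 0 :=
    (LinearMap.charpoly_monic _).ne_zero
  -- Step 2: `P(1+ℓ) = |det_ℂ((1+ℓ) − T_ℓ)|² = z²`
  have hPeval : P.eval (1 + (ℓ : ℤ)) = z ^ 2 := by
    have h1 := charpoly_restrictScalars_eval (heckeT (Gamma0 N) 2 ℓ) (((1 + (ℓ : ℤ) : ℤ) : ℝ))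
    rw [← hP, Polynomial.eval_intCast_map, Int.cast_id, eq_intCast,
      show ((((1 + (ℓ : ℤ) : ℤ) : ℝ) : ℂ)) = (1 : ℂ) + ℓ by push_cast; ring, ← hzdet,
      ← Complex.ofReal_intCast, Complex.normSq_ofReal] at h1
    rw [sq]
    exact_mod_cast h1
  -- Step 3: `f` and `i f` are real `a`-eigenvectors, so `(X − a)² ∣ P`
  have hTR : ∀ u : CuspForm (Gamma0 N) 2, heckeT (Gamma0 N) 2 ℓ u = (a : ℂ) • u →
      u ∈ Module.End.eigenspace ((heckeT (Gamma0 N) 2 ℓ).restrictScalars ℝ) (a : ℝ) := by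
    intro u hu
    rw [Module.End.mem_eigenspace_iff, LinearMap.coe_restrictScalars, hu, ← Complex.coe_smul,
      Complex.ofReal_intCast]
  have hIf : heckeT (Gamma0 N) 2 ℓ (Complex.I • f) = (a : ℂ) • (Complex.I • f) := by
    rw [map_smul, hTf, smul_comm]
  have hpair : LinearIndependent ℝ ![f, Complex.I • f] := by
    refine LinearIndependent.pair_iff.mpr fun s t hst ↦ ?_
    have h : ((s : ℂ) + t * Complex.I) • f = 0 := by
      rw [add_smul, mul_smul, Complex.coe_smul, Complex.coe_smul]
      exact hst
    have hst' : (s : ℂ) + t * Complex.I = 0 := (smul_eq_zero.mp h).resolve_right hf0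
    have h2 := Complex.ext_iff.mp hst'
    simp only [Complex.add_re, Complex.ofReal_re, Complex.mul_re, Complex.I_re, mul_zero,
      Complex.ofReal_im, Complex.I_im, mul_one, sub_self, add_zero, Complex.zero_re, Complex.add_im,
      Complex.mul_im, zero_add, Complex.zero_im] at h2
    exact h2
  have h2le : 2 ≤ ((heckeT (Gamma0 N) 2 ℓ).restrictScalars ℝ).charpoly.rootMultiplicity (a : ℝ) := by
    refine le_trans ?_ (LinearMap.finrank_eigenspace_le _ _)
    have hspan : Submodule.span ℝ (Set.range ![f, Complex.I • f]) ≤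
        Module.End.eigenspace ((heckeT (Gamma0 N) 2 ℓ).restrictScalars ℝ) (a : ℝ) := by
      rw [Submodule.span_le]
      rintro _ ⟨i, rfl⟩
      fin_cases i
      · exact hTR f hTf
      · exact hTR _ hIf
    calc 2 = Module.finrank ℝ (Submodule.span ℝ (Set.range ![f, Complex.I • f])) := by
          rw [finrank_span_eq_card hpair, Fintype.card_fin]
      _ ≤ _ := Submodule.finrank_mono hspan
  have hdvd : (X - C a) ^ 2 ∣ P := by
    rw [← Polynomial.map_dvd_map (Int.castRingHom ℝ) Int.cast_injective ((monic_X_sub_C a).pow 2), hP,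
      Polynomial.map_pow, Polynomial.map_sub, Polynomial.map_X, Polynomial.map_C, eq_intCast]
    exact (Polynomial.le_rootMultiplicity_iff hPne).mp h2le
  set ρ : ℤ[X] := P /ₘ ((X - C a) ^ 2) with hρ
  have hPρ : P = (X - C a) ^ 2 * ρ := by
    have hmonic : ((X - C a) ^ 2 : ℤ[X]).Monic := (monic_X_sub_C a).pow 2
    have h := Polynomial.modByMonic_add_div P ((X - C a) ^ 2)
    rw [(Polynomial.modByMonic_eq_zero_iff_dvd hmonic).mpr hdvd, zero_add] at h
    exact h.symm
  -- Step 4: 2-adic bookkeeping: `z² = (1+ℓ−a)² ρ(1+ℓ)`, so `ρ(1+ℓ)` is odd, hence `R = ρ(a)` is odd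
  set R : ℤ := ρ.eval a with hR
  have h2ca : (2 : ℤ) ∣ 1 + (ℓ : ℤ) - a := by
    obtain ⟨k, hk⟩ := hℓodd
    obtain ⟨m, hm⟩ := ha
    exact ⟨(k : ℤ) + 1 - m, by rw [hm, hk]; push_cast; ring⟩
  have hw : z ^ 2 = (1 + (ℓ : ℤ) - a) ^ 2 * ρ.eval (1 + (ℓ : ℤ)) := by
    rw [← hPeval, hPρ, Polynomial.eval_mul, Polynomial.eval_pow, Polynomial.eval_sub, Polynomial.eval_X,
      Polynomial.eval_C]
  have hca0 : 1 + (ℓ : ℤ) - a ≠ 0 := by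
    intro h
    rw [h, zero_pow two_ne_zero, zero_mul] at hw
    exact hz0 (pow_eq_zero_iff two_ne_zero |>.mp hw)
  have hw0 : ρ.eval (1 + (ℓ : ℤ)) ≠ 0 := by
    intro h
    rw [h, mul_zero] at hw
    exact hz0 (pow_eq_zero_iff two_ne_zero |>.mp hw)
  have hvw : padicValInt 2 (ρ.eval (1 + (ℓ : ℤ))) = 0 := by
    have h := congrArg (padicValInt 2) hw
    rw [sq, sq, padicValInt.mul hz0 hz0, padicValInt.mul (mul_ne_zero hca0 hca0) hw0,
      padicValInt.mul hca0 hca0, hzv] at h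
    omega
  have hwodd : ¬ (2 : ℤ) ∣ ρ.eval (1 + (ℓ : ℤ)) := by
    intro h
    have h' := (padicValInt_dvd_iff (p := 2) 1 (ρ.eval (1 + (ℓ : ℤ)))).mp (by rwa [pow_one])
    omega
  have hRodd : ¬ (2 : ℤ) ∣ R := by
    intro hR2
    have h2 : (2 : ℤ) ∣ ρ.eval (1 + (ℓ : ℤ)) - R :=
      dvd_trans h2ca (Polynomial.sub_dvd_eval_sub (1 + (ℓ : ℤ)) a ρ)
    exact hwodd (by simpa only [sub_add_cancel] using dvd_add h2 hR2)
  have hR0 : R ≠ 0 := fun h ↦ hRodd (by rw [h]; exact dvd_zero 2)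
  -- Step 5: `a` has multiplicity exactly two in `χ_ℝ(T_ℓ)`, so `ker(T_ℓ − a) = ℂ f`
  have hPR : ((heckeT (Gamma0 N) 2 ℓ).restrictScalars ℝ).charpoly =
      (X - C (a : ℝ)) ^ 2 * ρ.map (Int.castRingHom ℝ) := by
    rw [← hP, hPρ, Polynomial.map_mul, Polynomial.map_pow, Polynomial.map_sub, Polynomial.map_X,
      Polynomial.map_C, eq_intCast]
  have hρRa : (ρ.map (Int.castRingHom ℝ)).eval (a : ℝ) ≠ 0 := by
    rw [Polynomial.eval_intCast_map, Int.cast_id, eq_intCast]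
    exact_mod_cast hR0
  have hmult : ((heckeT (Gamma0 N) 2 ℓ).restrictScalars ℝ).charpoly.rootMultiplicity (a : ℝ) ≤ 2 := by
    have hne : (X - C (a : ℝ)) ^ 2 * ρ.map (Int.castRingHom ℝ) ≠ 0 := hPR ▸ hPne
    rw [hPR, Polynomial.rootMultiplicity_mul hne, Polynomial.rootMultiplicity_X_sub_C_pow,
      Polynomial.rootMultiplicity_eq_zero hρRa]
  have hone : ∀ u : CuspForm (Gamma0 N) 2, heckeT (Gamma0 N) 2 ℓ u = (a : ℂ) • u → u ∈ ℂ ∙ f := by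
    intro u hu
    by_contra hnot
    have h3 : LinearIndependent ℝ (Fin.cons u ![f, Complex.I • f] : Fin 3 → CuspForm (Gamma0 N) 2) := by
      rw [linearIndependent_finCons]
      refine ⟨hpair, fun hmem ↦ hnot ?_⟩
      obtain ⟨cf, hcf⟩ := (Submodule.mem_span_range_iff_exists_fun ℝ).mp hmem
      rw [Fin.sum_univ_two, Matrix.cons_val_zero, Matrix.cons_val_one, Matrix.cons_val_fin_one] at hcf
      rw [Submodule.mem_span_singleton]
      exact ⟨(cf 0 : ℂ) + cf 1 * Complex.I,
        by rw [add_smul, mul_smul, Complex.coe_smul, Complex.coe_smul, hcf]⟩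
    have hspan3 : Submodule.span ℝ (Set.range (Fin.cons u ![f, Complex.I • f] : Fin 3 → CuspForm (Gamma0 N) 2)) ≤
        Module.End.eigenspace ((heckeT (Gamma0 N) 2 ℓ).restrictScalars ℝ) (a : ℝ) := by
      rw [Submodule.span_le]
      rintro _ ⟨i, rfl⟩
      refine Fin.cases ?_ (fun j ↦ ?_) i
      · rw [Fin.cons_zero]
        exact hTR u hu
      · rw [Fin.cons_succ]
        fin_cases j
        · exact hTR f hTf
        · exact hTR _ hIf
    have h3le : 3 ≤ ((heckeT (Gamma0 N) 2 ℓ).restrictScalars ℝ).charpoly.rootMultiplicity (a : ℝ) := by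
      refine le_trans ?_ (LinearMap.finrank_eigenspace_le _ _)
      calc 3 = Module.finrank ℝ (Submodule.span ℝ
            (Set.range (Fin.cons u ![f, Complex.I • f] : Fin 3 → CuspForm (Gamma0 N) 2))) := by
            rw [finrank_span_eq_card h3, Fintype.card_fin]
        _ ≤ _ := Submodule.finrank_mono hspan3
    omega
  -- Step 6: eigenvalues of `T_ℓ` are real, so `ρ(λ) = 0` at every eigenvalue `λ ≠ a`
  have evalC : ∀ (q : ℤ[X]) (x : ℝ), (q.map (Int.castRingHom ℂ)).eval (x : ℂ) =
      (((q.map (Int.castRingHom ℝ)).eval x : ℝ) : ℂ) := by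
    intro q x
    rw [Polynomial.eval_map, Polynomial.eval_map,
      show Int.castRingHom ℂ = Complex.ofRealHom.comp (Int.castRingHom ℝ) from RingHom.ext_int _ _]
    change _ = Complex.ofRealHom (q.eval₂ (Int.castRingHom ℝ) x)
    rw [Polynomial.hom_eval₂]
    rfl
  have hq : ∀ lam : ℂ, lam ≠ (a : ℂ) → (heckeT (Gamma0 N) 2 ℓ).HasEigenvalue lam →
      (ρ.map (Int.castRingHom ℂ)).eval lam = 0 := by
    intro lam hlam hev
    obtain ⟨u, hu⟩ := hev.exists_hasEigenvector
    have huT : heckeT (Gamma0 N) 2 ℓ u = lam • u := hu.apply_eq_smul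
    have hu0 : u ≠ 0 := hu.2
    have hreal : (lam.re : ℂ) = lam := by
      have h := heckeT_selfAdjoint_holds N 2 ℓ hℓ hℓN u u
      rw [huT, peterssonProduct_smul_left, peterssonProduct_smul_right] at h
      have huu : peterssonProduct (Gamma0 N) 2 u u ≠ 0 :=
        fun h0 ↦ hu0 (eq_zero_of_peterssonProduct_self_eq_zero 2 u h0)
      exact Complex.conj_eq_iff_re.mp (mul_right_cancel₀ huu h)
    have hevR : Module.End.HasEigenvalue ((heckeT (Gamma0 N) 2 ℓ).restrictScalars ℝ) lam.re := by
      refine Module.End.hasEigenvalue_of_hasEigenvector ⟨?_, hu0⟩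
      rw [Module.End.mem_eigenspace_iff, LinearMap.coe_restrictScalars, huT, ← Complex.coe_smul, hreal]
    have hroot := (Module.End.hasEigenvalue_iff_isRoot_charpoly _ _).mp hevR
    rw [hPR, Polynomial.IsRoot, Polynomial.eval_mul, Polynomial.eval_pow, Polynomial.eval_sub,
      Polynomial.eval_X, Polynomial.eval_C, mul_eq_zero] at hroot
    have hne : ((lam.re - a : ℝ)) ^ 2 ≠ 0 := by
      refine pow_ne_zero 2 (sub_ne_zero.mpr ?_)
      intro h
      apply hlam
      rw [← hreal, h, Complex.ofReal_intCast]
    rw [← hreal, evalC, hroot.resolve_left hne, Complex.ofReal_zero]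
  -- Step 7: `ρ(T_ℓ) = R · π_f` preserves `S(ℤ)`, so `R⟨f, g⟩/⟨f, f⟩ = a₁(ρ(T_ℓ) g) ∈ ℤ` for `g ∈ S(ℤ)`
  have hRC : (ρ.map (Int.castRingHom ℂ)).eval (a : ℂ) = (R : ℂ) := by
    rw [Polynomial.eval_intCast_map, Int.cast_id, eq_intCast]
  set L := integralCuspForms0 N 2 with hL
  have key : ∀ g ∈ L, ∃ m : ℤ, (m : ℂ) * c = (R : ℂ) * peterssonProduct (Gamma0 N) 2 f g := by
    intro g hg
    obtain ⟨μ, hμ, hμc⟩ :=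
      exists_aeval_heckeT_apply_eq_smul ℓ hℓ hℓN hf0 hTf hone (ρ.map (Int.castRingHom ℂ)) hq g
    rw [hRC] at hμc
    obtain ⟨m, hm⟩ := (aeval_heckeT_mem_integralCuspForms0 ℓ hℓ hℓN ρ hg) 1
    have hm' : (m : ℂ) = μ := by
      rw [hm, cuspCoeff, hμ, qExpansion_coeff_smul, show (qExpansion 1 ⇑f).coeff 1 = 1 from hf1, mul_one]
    exact ⟨m, by rw [hm', hμc]⟩
  -- Step 8: `S(ℤ)/(ℤf + (ℤf)^⊥) ↪ ℤ/R` (as in `congruenceNumber_dvd_prod_heckeCongruenceModulus`)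
  choose! n hn using key
  have hadd : ∀ g ∈ L, ∀ h ∈ L, n (g + h) = n g + n h := by
    intro g hg h hh
    have e : ((n (g + h) : ℤ) : ℂ) * c = ((n g + n h : ℤ) : ℂ) * c := by
      rw [hn _ (add_mem hg hh), peterssonProduct_add_right, mul_add, ← hn g hg, ← hn h hh, Int.cast_add, add_mul]
    exact_mod_cast mul_right_cancel₀ hc0 e
  set Rn : ℕ := R.natAbs with hRn
  haveI : NeZero Rn := ⟨Int.natAbs_ne_zero.mpr hR0⟩
  let φ : L →+ ZMod Rn := AddMonoidHom.mk' (fun g ↦ ((n g : ℤ) : ZMod Rn)) fun g h ↦ by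
    change ((n ((g : CuspForm (Gamma0 N) 2) + h) : ℤ) : ZMod Rn) = _
    rw [hadd _ g.2 _ h.2, Int.cast_add]
  have hφ : ∀ g : L, φ g = ((n g : ℤ) : ZMod Rn) := fun g ↦ rfl
  set H : Submodule ℤ L := ((ℤ ∙ f) ⊔ integralOrthogonal0 f).comap L.subtype with hH
  have hker : φ.ker = H.toAddSubgroup := by
    ext g
    rw [AddMonoidHom.mem_ker, Submodule.mem_toAddSubgroup, hH, Submodule.mem_comap,
      Submodule.subtype_apply, mem_span_sup_integralOrthogonal0_iff hfL g.2, hφ,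
      ZMod.intCast_zmod_eq_zero_iff_dvd, hRn, Int.natAbs_dvd]
    constructor
    · rintro ⟨m, hm⟩
      refine ⟨m, ?_⟩
      have e := hn g g.2
      rw [hm, Int.cast_mul, mul_assoc] at e
      exact (mul_left_cancel₀ (Int.cast_ne_zero.mpr hR0) e).symm
    · rintro ⟨m, hm⟩
      refine ⟨m, ?_⟩
      have e : ((n g : ℤ) : ℂ) * c = ((R * m : ℤ) : ℂ) * c := by
        rw [hn g g.2, hm, Int.cast_mul, mul_assoc]
      exact_mod_cast mul_right_cancel₀ hc0 e
  have hinj : Function.Injective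
      ((QuotientAddGroup.kerLift φ).comp (QuotientAddGroup.quotientAddEquivOfEq hker.symm).toAddMonoidHom) :=
    (QuotientAddGroup.kerLift_injective φ).comp (QuotientAddGroup.quotientAddEquivOfEq hker.symm).injective
  have hdvd := AddSubgroup.card_dvd_of_injective _ hinj
  rw [Nat.card_zmod] at hdvd
  have hdvd' : congruenceNumber f ∣ Rn := hdvd
  have hRnodd : Odd Rn := by
    rw [hRn, Int.natAbs_odd, ← Int.not_even_iff_odd, even_iff_two_dvd]
    exact hRodd
  exact hRnodd.of_dvd_nat hdvd'

end Summit.BirchSwinnertonDyer.BirchSwinnertonDyer.Theorems.ManinLocalTwoThree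

end
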